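import Literature.NumberTheory.NumberFields.RayClassFieldLocalTowerContainmentUnramified
import Mathlib.FieldTheory.PrimitiveElement
import HarnessLib

/-!
# A finite Galois unramified coefficient field containing the image of a ray class field: `E ⊇ E₀ ⊔ K_v·ι(K(𝔪))`
# (de Shalit II.4.3 «`Φ = K(𝔣)_𝔓 ⊆ K_𝔭^{nr}`»; Neukirch II §8 — the READING FIELD of the `𝔓`-adic reading of global data)

Topic `NumberTheory/NumberFields` (theorems only; no definition, no named fact, no instance, no `sorry`).  Sequel of
`RayClassFieldLocalTowerContainmentUnramified` (`ι(K(𝔪)) ⊆ K_v^{nr}` for `v ∤ 𝔪`, `ι = absClosureEmbedding K K_v`).  The measure lane of cell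
`bsd-print-cf2` reads global data living in a ray class field `K(𝔪)` (`v ∤ 𝔪`) into the valuation ring of a FINITE GALOIS unramified
coefficient field `E ⊆ K̄_v` (`DeShalit1987/RayClassFieldPAdicReading`: hypothesis `hE : ∀ y ∈ K(𝔪), ι y ∈ E`), while the relative
Coleman theory is set up over a coefficient field `E₀` fixed in advance (the `E m` of the two-variable measure); base change of
norm-coherent units (`RelNormCoherentUnits.baseChange`) lets one pass to any finite Galois unramified `E ⊇ E₀`.  This file supplies such
an `E` containing `ι(K(𝔪))`:

* `rootSet_minpoly_subset_rayClassField` — the `K`-conjugates in `K̄` of an element of `K(𝔪)` lie in `K(𝔪)` (`K(𝔪)/K` is normal);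
* `absClosureEmbedding_image_rootSet_minpoly` — `ι` maps them onto the roots in `K̄_v`;
* ★ `exists_finite_normal_adjoin_rootSet` — for `θ ∈ K(𝔪)`: `E₁ := K_v(roots of minpoly_K θ)` is finite and NORMAL over `K_v`, lies in
  `K_v^{nr}` (`v ∤ 𝔪`) and contains `ι(K⟮θ⟯)`;
* ★★ `exists_finite_galois_le_maxUnramified_forall_mem` — **for `v ∤ 𝔪 ≠ 0` and any finite Galois `E₀ ≤ K_v^{nr}` there is a finite
  Galois `E` with `E₀ ≤ E ≤ K_v^{nr}` and `ι(K(𝔪)) ⊆ E`** (`E := E₀ ⊔ E₁` for a primitive element `θ` of `K(𝔪)/K`);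
  `exists_finite_galois_le_maxUnramified_forall_mem_rayClassField` — the same without `E₀`.

Cell `bsd-print-cf2`, width seat `bsd-line-cf2-p1-w7` g15 (piece (RF)); nothing here closes a crux; no summit statement is proved;
BSD is not proved by any of this.

## References
* [deShalit1987] E. de Shalit, *Iwasawa theory of elliptic curves with complex multiplication* (1987), II §4.3 (p. 57: `Φ = K(𝔣)_𝔓 ⊆ K_𝔭^{nr}`),
  II §4.1 (2) (p. 55).
* [NeukirchANT1999] J. Neukirch, *Algebraic Number Theory* (1999), Ch. II §8 (embeddings into `K̄_𝔭` and completions of finite extensions).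
-/

noncomputable section

open NumberField IsDedekindDomain IsDedekindDomain.HeightOneSpectrum Field Polynomial
open scoped Classical IntermediateField

namespace Literature.NumberTheory.NumberFields

open Literature.NumberTheory.GaloisRepresentations
open Literature.NumberTheory.GaloisRepresentations.IsNonarchimedeanLocalField

variable {K : Type} [Field K] [NumberField K] {𝔪 : Ideal (𝓞 K)} {v : HeightOneSpectrum (𝓞 K)}

/-- **The `K`-conjugates of an element of `K(𝔪)` lie in `K(𝔪)`** (the ray class field is normal over `K`): the roots in `K̄` of
`minpoly K θ`, `θ ∈ K(𝔪)`, belong to `K(𝔪)`. [cite: NeukirchANT1999, Ch. VI §6 (ray class fields are Galois over K)] -/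
theorem rootSet_minpoly_subset_rayClassField (θ : rayClassField K 𝔪) :
    (minpoly K θ).rootSet (AlgebraicClosure K) ⊆ (rayClassField K 𝔪 : Set (AlgebraicClosure K)) := by
  have hsplit : ((minpoly K θ).map (algebraMap K (rayClassField K 𝔪))).Splits := Normal.splits (F := K) (inferInstance : Normal K (rayClassField K 𝔪)) θ
  rw [← hsplit.image_rootSet (rayClassField K 𝔪).val]
  rintro _ ⟨x, -, rfl⟩
  exact x.2

/-- `ι` maps the roots of `minpoly K θ` in `K̄` ONTO its roots in `K̄_v`. [cite: NeukirchANT1999, Ch. II §8] -/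
theorem absClosureEmbedding_image_rootSet_minpoly (θ : rayClassField K 𝔪) :
    absClosureEmbedding K (v.adicCompletion K) '' (minpoly K θ).rootSet (AlgebraicClosure K) =
      (minpoly K θ).rootSet (AlgebraicClosure (v.adicCompletion K)) :=
  (IsAlgClosed.splits ((minpoly K θ).map (algebraMap K (AlgebraicClosure K)))).image_rootSet
    (absClosureEmbedding K (v.adicCompletion K))

/-- The roots in `K̄_v` of `(minpoly K θ).map (K → K_v)` are those of `minpoly K θ`. [cite: NeukirchANT1999, Ch. II §8] -/
theorem rootSet_map_minpoly (θ : rayClassField K 𝔪) :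
    ((minpoly K θ).map (algebraMap K (v.adicCompletion K))).rootSet (AlgebraicClosure (v.adicCompletion K)) =
      (minpoly K θ).rootSet (AlgebraicClosure (v.adicCompletion K)) := by
  rw [Polynomial.rootSet, Polynomial.rootSet, Polynomial.aroots_map]

/-- ★ **The field `E₁ = K_v(roots of minpoly_K θ)` for `θ ∈ K(𝔪)`, `v ∤ 𝔪`**: finite and normal over `K_v`, contained in `K_v^{nr}`, and
containing `ι(K⟮θ⟯)` — in particular `ι(K(𝔪))` when `θ` is a primitive element.
[cite: deShalit1987, II §4.3 (p. 57)] [cite: NeukirchANT1999, Ch. II §8] -/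
theorem exists_finite_normal_adjoin_rootSet (h𝔪 : 𝔪 ≠ ⊥) (hv : ¬ 𝔪 ≤ v.asIdeal) (θ : rayClassField K 𝔪) :
    ∃ E₁ : IntermediateField (v.adicCompletion K) (AlgebraicClosure (v.adicCompletion K)),
      FiniteDimensional (v.adicCompletion K) E₁ ∧ Normal (v.adicCompletion K) E₁ ∧ E₁ ≤ maxUnramified (v.adicCompletion K) ∧
      ∀ y : AlgebraicClosure K, y ∈ (K⟮θ⟯ : IntermediateField K (rayClassField K 𝔪)).map (rayClassField K 𝔪).val →
        absClosureEmbedding K (v.adicCompletion K) y ∈ E₁ := by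
  set F := v.adicCompletion K with hF
  set L := AlgebraicClosure (v.adicCompletion K) with hL
  set e := absClosureEmbedding K (v.adicCompletion K) with he
  set p : K[X] := minpoly K θ with hp
  set q : F[X] := p.map (algebraMap K F) with hq
  have hθint : IsIntegral K θ := IsIntegral.of_finite K θ
  have hp0 : p ≠ 0 := minpoly.ne_zero hθint
  set E₁ : IntermediateField F L := IntermediateField.adjoin F (q.rootSet L) with hE₁
  have hroots : q.rootSet L = p.rootSet L := rootSet_map_minpoly θ
  -- normal: a splitting field of `q`
  haveI hsplit : q.IsSplittingField F E₁ := IntermediateField.adjoin_rootSet_isSplittingField (IsAlgClosed.splits _)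
  haveI hnorm : Normal F E₁ := Normal.of_isSplittingField q
  -- finite: generated by finitely many algebraic elements
  haveI : Finite (q.rootSet L) := (Polynomial.rootSet_finite q L).to_subtype
  haveI hfd : FiniteDimensional F E₁ :=
    IntermediateField.finiteDimensional_adjoin fun x _ ↦ Algebra.IsIntegral.isIntegral x
  refine ⟨E₁, hfd, hnorm, ?_, ?_⟩
  · -- `E₁ ≤ K_v^{nr}`: the roots are `ι` of conjugates of `θ`, which lie in `K(𝔪)`
    rw [hE₁, IntermediateField.adjoin_le_iff, hroots, ← absClosureEmbedding_image_rootSet_minpoly θ]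
    rintro _ ⟨x, hx, rfl⟩
    exact absClosureEmbedding_mem_maxUnramified_of_mem_rayClassField h𝔪 hv (rootSet_minpoly_subset_rayClassField θ hx)
  · -- `ι(K⟮θ⟯) ⊆ E₁`: `K⟮θ⟯ = K[θ]` and `ι θ` is a root of `q`
    intro y hy
    obtain ⟨z, hz, rfl⟩ := (IntermediateField.mem_map _).mp hy
    have hz' : z ∈ (K⟮θ⟯ : IntermediateField K (rayClassField K 𝔪)).toSubalgebra := hz
    rw [IntermediateField.adjoin_simple_toSubalgebra_of_isAlgebraic hθint.isAlgebraic] at hz'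
    set t : AlgebraicClosure K := (rayClassField K 𝔪).val θ with ht
    -- `val z ∈ Algebra.adjoin K {t}`, hence `e (val z) ∈ Algebra.adjoin K {e t}`
    have h1 : (rayClassField K 𝔪).val z ∈ Algebra.adjoin K ((rayClassField K 𝔪).val '' {θ}) := by
      rw [Algebra.adjoin_image]
      exact Subalgebra.mem_map.mpr ⟨z, hz', rfl⟩
    rw [Set.image_singleton, ← ht] at h1
    have h2 : e ((rayClassField K 𝔪).val z) ∈ Algebra.adjoin K (e '' {t}) := by
      rw [Algebra.adjoin_image]
      exact Subalgebra.mem_map.mpr ⟨_, h1, rfl⟩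
    rw [Set.image_singleton] at h2
    -- `Algebra.adjoin K {e t} ≤ E₁` as `K`-subalgebras of `L`
    have htroot : t ∈ p.rootSet (AlgebraicClosure K) := by
      rw [Polynomial.mem_rootSet]
      exact ⟨hp0, by rw [ht, Polynomial.aeval_algHom_apply, minpoly.aeval, map_zero]⟩
    have hθE : e t ∈ E₁ := by
      refine IntermediateField.subset_adjoin F _ ?_
      rw [hroots, ← absClosureEmbedding_image_rootSet_minpoly θ]
      exact ⟨t, htroot, rfl⟩
    have hle : Algebra.adjoin K {e t} ≤ E₁.toSubalgebra.restrictScalars K :=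
      Algebra.adjoin_le (Set.singleton_subset_iff.mpr hθE)
    exact hle h2

/-- ★★ **A finite Galois unramified coefficient field containing `E₀` and `ι(K(𝔪))`**: for `v ∤ 𝔪 ≠ 0` and any finite Galois
`E₀ ≤ K_v^{nr}` there is a finite Galois `E` with `E₀ ≤ E ≤ K_v^{nr}` and `ι(K(𝔪)) ⊆ E` — the reading field (`hE` of
`DeShalit1987/RayClassFieldPAdicReading`) over which the measure lane's coefficient field `E₀` can be base-changed.
[cite: deShalit1987, II §4.3 (p. 57), II §4.1 (2) (p. 55)] [cite: NeukirchANT1999, Ch. II §8] -/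
theorem exists_finite_galois_le_maxUnramified_forall_mem (h𝔪 : 𝔪 ≠ ⊥) (hv : ¬ 𝔪 ≤ v.asIdeal)
    (E₀ : IntermediateField (v.adicCompletion K) (AlgebraicClosure (v.adicCompletion K)))
    [FiniteDimensional (v.adicCompletion K) E₀] [IsGalois (v.adicCompletion K) E₀] (hE₀ : E₀ ≤ maxUnramified (v.adicCompletion K)) :
    ∃ E : IntermediateField (v.adicCompletion K) (AlgebraicClosure (v.adicCompletion K)),
      FiniteDimensional (v.adicCompletion K) E ∧ IsGalois (v.adicCompletion K) E ∧ E₀ ≤ E ∧ E ≤ maxUnramified (v.adicCompletion K) ∧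
      ∀ y : AlgebraicClosure K, y ∈ rayClassField K 𝔪 → absClosureEmbedding K (v.adicCompletion K) y ∈ E := by
  haveI : CharZero (v.adicCompletion K) := charZero_of_injective_algebraMap (algebraMap K (v.adicCompletion K)).injective
  obtain ⟨θ, hθ⟩ := Field.exists_primitive_element K (rayClassField K 𝔪)
  obtain ⟨E₁, hfd, hnorm, hE₁, hmem⟩ := exists_finite_normal_adjoin_rootSet h𝔪 hv θ
  haveI := hfd
  haveI := hnorm
  refine ⟨E₀ ⊔ E₁, IntermediateField.finiteDimensional_sup E₀ E₁, isGalois_iff.2 ⟨inferInstance, inferInstance⟩, le_sup_left,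
    sup_le hE₀ hE₁, fun y hy ↦ ?_⟩
  refine (le_sup_right : E₁ ≤ E₀ ⊔ E₁) (hmem y ?_)
  rw [hθ]
  exact (IntermediateField.mem_map _).mpr ⟨⟨y, hy⟩, IntermediateField.mem_top, rfl⟩

/-- ★ The same without a prescribed `E₀`: **a finite Galois `E ≤ K_v^{nr}` with `ι(K(𝔪)) ⊆ E`** (`v ∤ 𝔪 ≠ 0`) — a reading field for
`DeShalit1987/RayClassFieldPAdicReading` (de Shalit's `Φ = K(𝔣)_𝔓` up to finite unramified enlargement).
[cite: deShalit1987, II §4.3 (p. 57)] [cite: NeukirchANT1999, Ch. II §8] -/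
theorem exists_finite_galois_le_maxUnramified_forall_mem_rayClassField (h𝔪 : 𝔪 ≠ ⊥) (hv : ¬ 𝔪 ≤ v.asIdeal) :
    ∃ E : IntermediateField (v.adicCompletion K) (AlgebraicClosure (v.adicCompletion K)),
      FiniteDimensional (v.adicCompletion K) E ∧ IsGalois (v.adicCompletion K) E ∧ E ≤ maxUnramified (v.adicCompletion K) ∧
      ∀ y : AlgebraicClosure K, y ∈ rayClassField K 𝔪 → absClosureEmbedding K (v.adicCompletion K) y ∈ E := by
  obtain ⟨E, hfd, hgal, -, hE, hmem⟩ :=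
    exists_finite_galois_le_maxUnramified_forall_mem h𝔪 hv (⊥ : IntermediateField (v.adicCompletion K) (AlgebraicClosure (v.adicCompletion K)))
      bot_le
  exact ⟨E, hfd, hgal, hE, hmem⟩

end Literature.NumberTheory.NumberFields

end
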